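import Mathlib
import Literature.Computability.AlgebraicComplexity.BorderRankMatMulSmallLMProofs
import Literature.Computability.AlgebraicComplexity.BorderRankMatMulTwoHolds
import Literature.Computability.AlgebraicComplexity.BorderRankMatMulThreeSeventeen

/-!
# Witness (F3 / BC5) for the rung `BorderRankTwoNSquared` of crux `FixedPointFreeTargets`
(stmt-MatrixMultiplication-15042): the rung family specialises to the PROVED floor

Rung family (same text as `Lines/BorderRankTwoNSquared.lean`):
`DeficitRung t : ∃ n₀, ∀ n ≥ n₀, 2n² ≤ bR(⟨n,n,n⟩) + t(n)` over `ℂ`; the filed rung is `DeficitRung 0`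
(= `BorderRankTwoNSquared`).  FLOOR = `DeficitRung (⌈log₂ n⌉ + 1)`, Landsberg–Michałek 2018 Thm. 1.1,
PROVED in tree (`LandsbergMichalek2018_borderRank_matMulTensor_holds`, sorry-free, incl. Thm. 1.1
itself `LandsbergMichalek2018_thm_1_1_holds`).  Instance rungs in tree: deficit `1` at `n = 2`
(`bR(⟨2,2,2⟩) = 7`, Landsberg 2006) and at `n = 3` (`bR(⟨3,3,3⟩) ≥ 17`, Conner–Harper–Landsberg 2023,
`seventeen_le_algBorderRank_matMulTensor_three`).  No sorry in this file.

witness_regime: border-rank lower bounds for ⟨n,n,n⟩ at deficit ⌈log₂ n⌉+1 below 2n² (all n ≥ 1);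
S (ω(ℂ) = 2) known there: no — S is open in every regime, and the floor is compatible with both ω = 2
and ω > 2.
-/

set_option linter.dupNamespace false

noncomputable section

namespace Summit.MatrixMultiplication.MatrixMultiplication.Cruxes.FixedPointFreeTargets.BorderRankTwoNSquared.Special

open Literature.Computability.AlgebraicComplexity

/-- Rung family (copy of the line file's `DeficitRung`). [cite: LandsbergMichalek2018, Thm. 1.1] -/
def DeficitRung (t : ℕ → ℕ) : Prop :=
  ∃ n₀ : ℕ, ∀ n : ℕ, n₀ ≤ n → 2 * n ^ 2 ≤ algBorderRank (matMulTensor ℂ n n n) + t n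

/-- The filed rung (copy of the line file's `BorderRankTwoNSquared` = `DeficitRung 0`).
[cite: LandsbergMichalek2018, §1 (last paragraph)] -/
def BorderRankTwoNSquared : Prop :=
  ∃ n₀ : ℕ, ∀ n : ℕ, n₀ ≤ n → 2 * n ^ 2 ≤ algBorderRank (matMulTensor ℂ n n n)

/-- The rung is the deficit-`0` member. [folklore] -/
example : BorderRankTwoNSquared ↔ DeficitRung 0 := by simp [BorderRankTwoNSquared, DeficitRung]

/-- **THE WITNESS: the rung family at the floor parameter `t = ⌈log₂ n⌉ + 1` is Landsberg–Michałek
2018, Thm. 1.1, proved in tree.** [cite: LandsbergMichalek2018, Thm. 1.1] -/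
theorem deficitRung_floor : DeficitRung fun n => Nat.clog 2 n + 1 :=
  ⟨1, fun n hn => by simpa [add_assoc] using LandsbergMichalek2018_borderRank_matMulTensor_holds n hn⟩

/-- The F3 shape verbatim. [cite: LandsbergMichalek2018, Thm. 1.1] -/
example : DeficitRung fun n => Nat.clog 2 n + 1 := by
  simpa [DeficitRung, add_assoc] using
    (⟨1, LandsbergMichalek2018_borderRank_matMulTensor_holds⟩ :
      ∃ n₀ : ℕ, ∀ n : ℕ, n₀ ≤ n → 2 * n ^ 2 ≤ algBorderRank (matMulTensor ℂ n n n) + Nat.clog 2 n + 1)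

/-- Instance rung `n = 2`, deficit `1` (sharp: `bR(⟨2,2,2⟩) = 7`). [cite: Landsberg2005, main theorem (p. 447)] -/
example : 2 * 2 ^ 2 ≤ algBorderRank (matMulTensor ℂ 2 2 2) + 1 := by
  rw [algBorderRank_matMulTensor_two ℂ]
  norm_num

/-- Instance rung `n = 3`, deficit `1` (`bR(⟨3,3,3⟩) ≥ 17`, CHL 2023 Thm. 1.1, proved in tree); deficit
`0` at `n = 3` (`bR ≥ 18`) is OPEN. [cite: ConnerHarperLandsberg2023, Thm. 1.1] -/
example : 2 * 3 ^ 2 ≤ algBorderRank (matMulTensor ℂ 3 3 3) + 1 := by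
  have := seventeen_le_algBorderRank_matMulTensor_three ℂ
  omega

/-- The eventual quantifier of the rung is forced: deficit `0` fails at `n = 2`.
[cite: Landsberg2005, main theorem (p. 447)] -/
example : ¬ ∀ n : ℕ, 2 ≤ n → 2 * n ^ 2 ≤ algBorderRank (matMulTensor ℂ n n n) := by
  intro h
  have h2 := h 2 le_rfl
  rw [algBorderRank_matMulTensor_two ℂ] at h2
  omega

end Summit.MatrixMultiplication.MatrixMultiplication.Cruxes.FixedPointFreeTargets.BorderRankTwoNSquared.Special

end
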